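import Literature.MathematicalPhysics.QuantumFieldTheory.Balaban1983to89.Node00.LocalizedSum17Chi
import Literature.MathematicalPhysics.QuantumFieldTheory.Balaban1983to89.Node00.U3KernelLettersChi

/-!
# K0ᴬ ∕ K3ᴬ SUPPLY — THE READING-SIDE FACES AT THE β-SLOT χ AND AT THE RE-CENTRED RECORD: under W1-20's (1.7) law read at χ (`LocalizedSum17.Localizes17OfRecord₁₃Chi θ χ S emb`),
# node U3's χ-objects `objectsOfRecord₁₃Chi θ χ` ARE the kernel objects of the W1 reading, every predicate of them transfers, and each of the ✓p811021 χ∕Ax letters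
# (`PolLimitsExist ∕ WindowedNE9 ∕ WindowedDecay ∕ GeometricIncrements ∕ PolLimitsExistBox ∕ WindowedStepRate ∕ KernelStepRate ∕ WindowedDecayUniform ∕ KernelDecay …OfRecord₁₃Chi`) ⟺ the same GENERIC
# letter at the reading's localized sum — the χ∕Ax editions of W1-19b∕19c∕20's `…_iff_of_localizes` rows (estimate-free transfers, by name)

Cell `pub-ymgap` (YM-PLAN Track A, D-0062), width seat `pub-ymgap-dag-n07-w3` (g23).  `--kind proof --supports stmt-QuantumFields-27238 --as helper` (K0ᴬ cone; equally a K3ᴬ 27247 supply —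
count-neutral either way).  NEW leaf; theorems only — 0 `def`, 0 `sorry`; standard axioms.  Imports this seat's Literature `Node00/LocalizedSum17Chi` (the χ law, statement-only) and ✓p811021
`Node00/U3KernelLettersChi`; uses W1-19b∕19c∕20's GENERIC transfer rows by name (`objects_eq_objects_localizedSum_of`, `polLimitsExist_iff_of_eventuallyAgree`, …, `Localizes17.eventuallyAgree`).
[I] = [Balaban1987RG1]; [RG2] = [Balaban1988RG2Cluster].

HONEST FRAMING.  Filter-congruence bookkeeping under a DISPLAYED law (inhabited by nobody: the cluster expansion of the RG-defined actions); no letter inhabited; nothing of Bałaban asserted;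
K0ᴬ ∕ K1ᴬ ∕ K3ᴬ OPEN; N07 NOT discharged; COUNT 8∕28 · K 1∕4 UNMOVED; R4 = the CONDITIONAL finite-𝕋⁴ rung `BalabanLadder.UV` only; the Yang–Mills mass gap (Clay) is NOT proved by any of this.
-/

noncomputable section

open scoped Matrix.Norms.L2Operator

namespace Summit.QuantumFields.YangMills.Theorems.U3LettersAtReadingChi

open Literature.MathematicalPhysics.QuantumFieldTheory.Balaban1983to89
open Literature.MathematicalPhysics.QuantumFieldTheory.Balaban1983to89.Node00
open Literature.MathematicalPhysics.QuantumFieldTheory.Balaban1983to89.T4Continuum (T4Family)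
open Literature.MathematicalPhysics.QuantumFieldTheory.Balaban1983to89.T4OutputRate (Window)
open Literature.MathematicalPhysics.QuantumFieldTheory.Balaban1983to89.Node00.W1 (ClusterTower)
open Literature.MathematicalPhysics.QuantumFieldTheory.Balaban1983to89.Node00.U3OfKernels (objectsOfRecord₁₃Chi KernelDecayOfRecord₁₃Chi KernelDecay)
open Literature.MathematicalPhysics.QuantumFieldTheory.Balaban1983to89.Node00.U3KernelLetters
open Literature.MathematicalPhysics.QuantumFieldTheory.Balaban1983to89.Node00.U3KernelLetters2 (WindowedDecayUniform windowedDecayUniform_iff_of_eventuallyAgree)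
open Literature.MathematicalPhysics.QuantumFieldTheory.Balaban1983to89.Node00.LocalizedSum17

variable (F : T4Family) (N : ℕ) [NeZero N] {𝔸 : Type*} {M : ℕ}
variable (θ : Stage13Params F N) (χ : ChiSlot F N) (S : (K : ℕ) → ClusterTower (F.P K) 𝔸 M) (emb : ReadingMaps F (MatA N) 𝔸)

/-- ★★ **UNDER THE χ-LAW, NODE U3's χ-OBJECTS OF RECORD ARE THE KERNEL OBJECTS OF THE W1 READING** (`objectsOfReading₁₃` is χ-free: it reads the reading's towers in θ's chart).
[cite: Balaban1987RG1, (1.7) p.261 and (1.20)–(1.22) p.264; Balaban1988RG2Cluster, (2.14) p.15] -/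
theorem objectsOfRecord₁₃Chi_eq_objectsOfReading_of (h : Localizes17OfRecord₁₃Chi F N θ χ S emb) (ℓ : U3Letters₁₁) :
    objectsOfRecord₁₃Chi F N θ χ ℓ = objectsOfReading₁₃ F N θ S emb ℓ := by
  letI := θ.instVβ₁; letI := θ.instVβ₂; letI := θ.instιβ
  show U3OfKernels.objects F _ θ.ρ8 θ.bV ℓ = U3OfKernels.objects F _ θ.ρ8 θ.bV ℓ
  exact objects_eq_objects_localizedSum_of F θ.ρ8 θ.bV S emb h ℓ

/-- ★★ **EVERY PREDICATE OF NODE U3's OBJECTS TRANSFERS under the χ-law** (the Summit side's `N22At ∕ N18At ∕ ReadOutAt ∕ SensitiveOnBoxes …` at the χ∕Ax objects).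
[cite: Balaban1987RG1, (1.7) p.261 and (1.20)–(1.22) p.264 (bookkeeping)] -/
theorem iff_of_localizes17OfRecord₁₃Chi (h : Localizes17OfRecord₁₃Chi F N θ χ S emb) (ℓ : U3Letters₁₁) (P : U3Objects₁₁ → Prop) :
    P (objectsOfRecord₁₃Chi F N θ χ ℓ) ↔ P (objectsOfReading₁₃ F N θ S emb ℓ) := by
  rw [objectsOfRecord₁₃Chi_eq_objectsOfReading_of F N θ χ S emb h ℓ]

/-- The χ (5.10) clause ⟺ the (5.10)-class binder of the LOCALIZED SUM's limiting kernels on the window. [cite: Balaban1987RG1, (5.10) p.293, (1.7) p.261 and (1.21) p.264] -/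
theorem kernelDecayOfRecord₁₃Chi_iff_of_localizes (h : Localizes17OfRecord₁₃Chi F N θ χ S emb) (μ ν : Fin 4) (κ : ℝ) :
    KernelDecayOfRecord₁₃Chi F N θ χ μ ν κ ↔
      (letI := θ.instVβ₁; letI := θ.instVβ₂; letI := θ.instιβ
       KernelDecay F (localizedSum F S emb) θ.ρ8 θ.bV (Window θ.γ) μ ν κ) := by
  letI := θ.instVβ₁; letI := θ.instVβ₂; letI := θ.instιβ
  exact kernelDecay_iff_of_eventuallyAgree F θ.ρ8 θ.bV (h.eventuallyAgree F) (Window θ.γ) μ ν κ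

/-- READING SIDE at χ: (1.21)-existence of record ⟺ (1.21)-existence for the reading's localized sum. [cite: Balaban1987RG1, (1.7) p.261 and (1.21) p.264; Balaban1988RG2Cluster, (2.14) p.15] -/
theorem polLimitsExistOfRecord₁₃Chi_iff_of_localizes (h : Localizes17OfRecord₁₃Chi F N θ χ S emb) :
    PolLimitsExistOfRecord₁₃Chi F N θ χ ↔
      (letI := θ.instVβ₁; letI := θ.instVβ₂; letI := θ.instιβ
       PolLimitsExist F (localizedSum F S emb) θ.ρ8 θ.bV (Window θ.γ)) := by
  letI := θ.instVβ₁; letI := θ.instVβ₂; letI := θ.instιβ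
  exact polLimitsExist_iff_of_eventuallyAgree F θ.ρ8 θ.bV (h.eventuallyAgree F) (Window θ.γ)

/-- READING SIDE at χ: windowed NE9. [cite: Balaban1987RG1, (1.7) p.261 and (1.18) p.263; Balaban1988RG2Cluster, (2.14) p.15] -/
theorem windowedNE9OfRecord₁₃Chi_iff_of_localizes (h : Localizes17OfRecord₁₃Chi F N θ χ S emb) (κ : ℝ) (Λ : ℕ → ℕ → ℝ) :
    WindowedNE9OfRecord₁₃Chi F N θ χ κ Λ ↔
      (letI := θ.instVβ₁; letI := θ.instVβ₂; letI := θ.instιβ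
       WindowedNE9 F (localizedSum F S emb) θ.ρ8 θ.bV (Window θ.γ) κ Λ) := by
  letI := θ.instVβ₁; letI := θ.instVβ₂; letI := θ.instιβ
  exact windowedNE9_iff_of_eventuallyAgree F θ.ρ8 θ.bV (h.eventuallyAgree F) (Window θ.γ) κ Λ

/-- READING SIDE at χ: windowed (5.10) decay. [cite: Balaban1987RG1, (1.7) p.261 and (5.10) p.293; Balaban1988RG2Cluster, (2.14) p.15] -/
theorem windowedDecayOfRecord₁₃Chi_iff_of_localizes (h : Localizes17OfRecord₁₃Chi F N θ χ S emb) (μ ν : Fin 4) (κ : ℝ) :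
    WindowedDecayOfRecord₁₃Chi F N θ χ μ ν κ ↔
      (letI := θ.instVβ₁; letI := θ.instVβ₂; letI := θ.instιβ
       WindowedDecay F (localizedSum F S emb) θ.ρ8 θ.bV (Window θ.γ) μ ν κ) := by
  letI := θ.instVβ₁; letI := θ.instVβ₂; letI := θ.instιβ
  exact windowedDecay_iff_of_eventuallyAgree F θ.ρ8 θ.bV (h.eventuallyAgree F) (Window θ.γ) μ ν κ

/-- READING SIDE at χ: geometric increments. [cite: Balaban1987RG1, (1.7) p.261 and (1.21) p.264; Balaban1988RG2Cluster, (2.14) p.15] -/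
theorem geometricIncrementsOfRecord₁₃Chi_iff_of_localizes (h : Localizes17OfRecord₁₃Chi F N θ χ S emb) (r : ℝ) :
    GeometricIncrementsOfRecord₁₃Chi F N θ χ r ↔
      (letI := θ.instVβ₁; letI := θ.instVβ₂; letI := θ.instιβ
       GeometricIncrements F (localizedSum F S emb) θ.ρ8 θ.bV (Window θ.γ) r) := by
  letI := θ.instVβ₁; letI := θ.instVβ₂; letI := θ.instιβ
  exact geometricIncrements_iff_of_eventuallyAgree F θ.ρ8 θ.bV (h.eventuallyAgree F) (Window θ.γ) r

/-- READING SIDE at χ: (1.21)-existence, box form. [cite: Balaban1987RG1, (1.7) p.261 and (1.21) p.264; Balaban1988RG2Cluster, (2.14) p.15] -/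
theorem polLimitsExistBoxOfRecord₁₃Chi_iff_of_localizes (h : Localizes17OfRecord₁₃Chi F N θ χ S emb) :
    PolLimitsExistBoxOfRecord₁₃Chi F N θ χ ↔
      (letI := θ.instVβ₁; letI := θ.instVβ₂; letI := θ.instιβ
       PolLimitsExistBox F (localizedSum F S emb) θ.ρ8 θ.bV θ.γ) := by
  letI := θ.instVβ₁; letI := θ.instVβ₂; letI := θ.instιβ
  exact polLimitsExistBox_iff_of_eventuallyAgree F θ.ρ8 θ.bV (h.eventuallyAgree F) θ.γ

/-- READING SIDE at χ: the windowed two-run step rate. [cite: Balaban1987RG1, (1.7) p.261 and Thm 1 p.259; Balaban1988RG2Cluster, (2.14) p.15] -/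
theorem windowedStepRateOfRecord₁₃Chi_iff_of_localizes (h : Localizes17OfRecord₁₃Chi F N θ χ S emb) (s : ℕ) (κ θ₅ C' : ℝ) :
    WindowedStepRateOfRecord₁₃Chi F N θ χ s κ θ₅ C' ↔
      (letI := θ.instVβ₁; letI := θ.instVβ₂; letI := θ.instιβ
       WindowedStepRate F (localizedSum F S emb) θ.ρ8 θ.bV θ.γ s κ θ₅ C') := by
  letI := θ.instVβ₁; letI := θ.instVβ₂; letI := θ.instιβ
  exact windowedStepRate_iff_of_eventuallyAgree F θ.ρ8 θ.bV (h.eventuallyAgree F) θ.γ s κ θ₅ C'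

/-- READING SIDE at χ: the kernel step rate. [cite: Balaban1987RG1, (1.7) p.261 and Thm 1 p.259; Balaban1988RG2Cluster, (2.14) p.15] -/
theorem kernelStepRateOfRecord₁₃Chi_iff_of_localizes (h : Localizes17OfRecord₁₃Chi F N θ χ S emb) (κ θ₅ C₅ : ℝ) :
    KernelStepRateOfRecord₁₃Chi F N θ χ κ θ₅ C₅ ↔
      (letI := θ.instVβ₁; letI := θ.instVβ₂; letI := θ.instιβ
       KernelStepRate F (localizedSum F S emb) θ.ρ8 θ.bV θ.γ κ θ₅ C₅) := by
  letI := θ.instVβ₁; letI := θ.instVβ₂; letI := θ.instιβ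
  exact kernelStepRate_iff_of_eventuallyAgree F θ.ρ8 θ.bV (h.eventuallyAgree F) θ.γ κ θ₅ C₅

/-- READING SIDE at χ: the uniform windowed (5.10) decay. [cite: Balaban1987RG1, (1.7) p.261 and (5.10) p.293; Balaban1988RG2Cluster, (2.14) p.15] -/
theorem windowedDecayUniformOfRecord₁₃Chi_iff_of_localizes (h : Localizes17OfRecord₁₃Chi F N θ χ S emb) (E₀ δ : ℝ) :
    WindowedDecayUniformOfRecord₁₃Chi F N θ χ E₀ δ ↔
      (letI := θ.instVβ₁; letI := θ.instVβ₂; letI := θ.instιβ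
       WindowedDecayUniform F (localizedSum F S emb) θ.ρ8 θ.bV (Window θ.γ) E₀ δ) := by
  letI := θ.instVβ₁; letI := θ.instVβ₂; letI := θ.instιβ
  exact windowedDecayUniform_iff_of_eventuallyAgree F θ.ρ8 θ.bV (h.eventuallyAgree F) (Window θ.γ) E₀ δ

end Summit.QuantumFields.YangMills.Theorems.U3LettersAtReadingChi

end
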